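import Summits.CriticalPhenomena.PercolationContinuityZ3.Theorems.PercNearOneGluingNoHeavyPcintChainBondUnits
import Summits.CriticalPhenomena.PercolationContinuityZ3.Theorems.PercNearOneGluingNoHeavyPcintChainBondIneq
import HarnessLib

/-!
# PCINT lane, reduction B3c (`chordchain_cw`): the event of a word, forcing, and the per-site probability bound

Cell `prim-pcint` (PAPER-2 track (iii): certified intervals for `p_c(ℤ^d)`), seat `prim-pcint-2` (gen 4); support file
(`--supports stmt-CriticalPhenomena-4575`).  Does NOT build on p205010.  Memo: `run/shared/lean/prim/pcint/REDUCTIONS.md` §B3c.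

For a family `o` of sibling orders and a word `γ` the B3c event is
`chainEvent o γ = baseEvt γ ∩ ⋂_{w ∈ offSites γ} siteEvt o γ w`: edges of `γ` open, chords closed, and at every off-path site `w`
NO BAD PAIR of incidence edges open together, where a pair of incidence times `i < j` of `w` is bad if `j ≥ i + 3` (a
shortcut) or if it is the `o`-bad corner pair `(i, i+2)` at the corner site (a lex-smaller flip).  PROVED here:
* forcing: the code-least open geodesic word realises its event (`mem_chainEvent_of_minimal`, from the forcing lemmas of
  `…PcintChordRandForcing`), and covering of `{0 ↔ ∞}`;
* the per-site bound `P(siteEvt) ≤ siteProb r g p` (`…ChainBondIneq`): the open incidence edges form a set of size `≤ 1`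
  or a GOOD corner pair (`real_siteEvt_le_siteProb`), `g` = number of good corner pairs;
* combined with the unit structure of `…ChainBondUnits`: `P(siteEvt o γ w) ≤ s^{detUnits + 2·#badFiber}`
  (`real_siteEvt_le_pow`, `0 ≤ p ≤ 1/2`, `s² ≥ 1 - p²`, `kc ≥ 2`);
* finite dependence and disjointness of the incidence edge sets (`incEdges`), for the product formula in
  `…PcintChainBondReduction`.
-/

noncomputable section

namespace Summit.CriticalPhenomena.PercolationContinuityZ3.Theorems.Pcint

open Finset MeasureTheory Literature.Probability.Percolation Literature.Probability.LatticeModels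

variable {d n : ℕ}

namespace ChainBond

/-! ### Bad pairs, the site event, the event of a word -/

/-- A BAD PAIR of incidence times `i < j` at the site `w`: a shortcut pair (`j ≥ i + 3`), or the corner pair `(i, i+2)` at
the corner site with an `o`-bad corner. [folklore] -/
def IsBadPair (o : Orders d n) (γ : Fin n → Fin d × Bool) (w : Site d) (i j : ℕ) : Prop :=
  i + 3 ≤ j ∨ (j = i + 2 ∧ cornerSite γ i = w ∧ IsBad o γ i)

/-- The SITE EVENT: no bad pair of incidence edges at `w` is open. [folklore] -/
def siteEvt (o : Orders d n) (γ : Fin n → Fin d × Bool) (w : Site d) : Set (BondConfig (Site d)) :=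
  {ω | ∀ i ∈ incTimes γ w, ∀ j ∈ incTimes γ w, i < j → IsBadPair o γ w i j →
    ¬ (s(wordPos γ i, w) ∈ ω ∧ s(wordPos γ j, w) ∈ ω)}

/-- The B3c event of a word under `o`. [folklore] -/
def chainEvent (o : Orders d n) (γ : Fin n → Fin d × Bool) : Set (BondConfig (Site d)) :=
  baseEvt γ ∩ ⋂ w ∈ offSites γ, siteEvt o γ w

/-- **Forcing (B3c).** The code-least open geodesic word realises its event. [folklore] -/
theorem mem_chainEvent_of_minimal {ω : BondConfig (Site d)} (hω : ω ⊆ (zdGraph d).edgeSet)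
    {o : Orders d n} {γ : Fin n → Fin d × Bool} (hγ : γ ∈ bgeoWords ω n)
    (hmin : ∀ γ' ∈ bgeoWords ω n, code o γ ≤ code o γ') : ω ∈ chainEvent o γ := by
  refine ⟨⟨(mem_bgeoWords.1 hγ).1, Set.disjoint_left.2 fun e he heω =>
    chord_not_mem_of_mem_bgeoWords hγ (mem_coe.1 he) heω⟩, ?_⟩
  simp only [Set.mem_iInter]
  intro w _ i _ j hj _ hbad hopen
  obtain ⟨hjn, -⟩ := mem_incTimes.1 hj
  rcases hbad with hgap | ⟨rfl, hcw, hb⟩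
  · exact not_pairOpen_of_gap hω hγ hgap hjn ⟨hopen.1, by rw [Sym2.eq_swap]; exact hopen.2⟩
  · rw [← hcw] at hopen
    exact not_cornerPairOpen_of_minimal hγ hmin hb ⟨hopen.1, by rw [Sym2.eq_swap]; exact hopen.2⟩

/-- **Covering.** `{0 ↔ ∞} ⊆ ⋃_{γ SAW} chainEvent o γ ∪ {ω ⊄ E(𝕃^d)}`. [folklore] -/
theorem percolatesAt_subset_biUnion_chainEvent (o : Orders d n) :
    (percolatesAt (0 : Site d) : Set (BondConfig (Site d))) ⊆
      (⋃ γ ∈ sawWords d n, chainEvent o γ) ∪ {ω | ¬ ω ⊆ (zdGraph d).edgeSet} := by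
  intro ω hω
  by_cases hb : ω ⊆ (zdGraph d).edgeSet
  · obtain ⟨γ, hγ, hmin⟩ := exists_minimal_bgeoWord hb hω o
    exact Or.inl (Set.mem_biUnion (mem_coe.2 (mem_sawWords_of_mem_bgeoWords hγ))
      (mem_chainEvent_of_minimal hb hγ hmin))
  · exact Or.inr hb

/-! ### Incidence edges: finite dependence and disjointness -/

/-- The incidence edges `{v_t, w}` of a site. [folklore] -/
def incEdges (γ : Fin n → Fin d × Bool) (w : Site d) : Finset (Sym2 (Site d)) :=
  (incTimes γ w).image fun t => s(wordPos γ t, w)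

/-- Incidence edges are lattice edges. [folklore] -/
theorem incEdges_subset_edgeSet (γ : Fin n → Fin d × Bool) (w : Site d) :
    (↑(incEdges γ w) : Set (Sym2 (Site d))) ⊆ (zdGraph d).edgeSet := by
  intro e he
  obtain ⟨t, ht, rfl⟩ := mem_image.1 (mem_coe.1 he)
  exact (mem_incTimes.1 ht).2

/-- For a self-avoiding word, the incidence edges of an off-path site are indexed injectively by the incidence times.
[folklore] -/
theorem incEdges_injOn {γ : Fin n → Fin d × Bool} (hs : IsSAW γ) {w : Site d} (hw : w ∉ pathSites γ) :
    Set.InjOn (fun t => s(wordPos γ t, w)) ↑(incTimes γ w) := by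
  intro t ht t' ht' h
  exact (eq_of_siteEdge_eq hs hw (mem_incTimes.1 (mem_coe.1 ht)).1 (mem_incTimes.1 (mem_coe.1 ht')).1 h).2

/-- Hence `#incEdges = #incTimes`. [folklore] -/
theorem card_incEdges {γ : Fin n → Fin d × Bool} (hs : IsSAW γ) {w : Site d} (hw : w ∉ pathSites γ) :
    (incEdges γ w).card = (incTimes γ w).card :=
  card_image_of_injOn (incEdges_injOn hs hw)

/-- The site event is determined by the incidence edges. [folklore] -/
theorem determinedBy_siteEvt (o : Orders d n) (γ : Fin n → Fin d × Bool) (w : Site d) :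
    DeterminedBy (siteEvt o γ w) (↑(incEdges γ w) : Set (Sym2 (Site d))) := by
  rw [determinedBy_iff]
  intro ω ω' h
  have key : ∀ e ∈ (↑(incEdges γ w) : Set (Sym2 (Site d))), e ∈ ω ↔ e ∈ ω' := by
    intro e he
    constructor
    · intro heω; have : e ∈ ω ∩ ↑(incEdges γ w) := ⟨heω, he⟩; rw [h] at this; exact this.1
    · intro heω; have : e ∈ ω' ∩ ↑(incEdges γ w) := ⟨heω, he⟩; rw [← h] at this; exact this.1
  have hk : ∀ t ∈ incTimes γ w, (s(wordPos γ t, w) ∈ ω ↔ s(wordPos γ t, w) ∈ ω') := fun t ht =>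
    key _ (mem_coe.2 (mem_image.2 ⟨t, ht, rfl⟩))
  simp only [siteEvt, Set.mem_setOf_eq]
  refine forall₂_congr fun i hi => forall₂_congr fun j hj => ?_
  rw [hk i hi, hk j hj]

/-- Incidence edges of distinct off-path sites are disjoint. [folklore] -/
theorem incEdges_disjoint {γ : Fin n → Fin d × Bool} (hs : IsSAW γ) {w w' : Site d} (hw : w ∉ pathSites γ)
    (hne : w ≠ w') : Disjoint (incEdges γ w) (incEdges γ w') := by
  rw [disjoint_left]
  intro e he he'
  obtain ⟨t, ht, rfl⟩ := mem_image.1 he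
  obtain ⟨t', ht', h⟩ := mem_image.1 he'
  exact hne (eq_of_siteEdge_eq hs hw (mem_incTimes.1 ht).1 (mem_incTimes.1 ht').1 h.symm).1

/-- Incidence edges of an off-path site avoid the path edges and the chords. [folklore] -/
theorem disjoint_base_incEdges {γ : Fin n → Fin d × Bool} {w : Site d} (hw : w ∉ pathSites γ) :
    Disjoint (wordEdges γ ∪ chordEdges γ) (incEdges γ w) := by
  rw [disjoint_right]
  intro e he heb
  obtain ⟨t, -, rfl⟩ := mem_image.1 he
  rcases mem_union.1 heb with heb | heb
  · rw [wordEdges, mem_image] at heb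
    obtain ⟨k, hk, hke⟩ := heb
    rw [mem_range] at hk
    exact ne_of_offPath hw (by omega : k ≤ n) (by omega : k + 1 ≤ n) hke.symm
  · obtain ⟨a, b, hab, hbn, -, hke⟩ := mem_chordEdges.1 heb
    exact ne_of_offPath hw (by omega : a ≤ n) hbn hke

/-! ### The per-site probability bound -/

open Classical in
/-- The GOOD corner pairs of a site under `o`: consecutive incidences `t_{k+1} = t_k + 2` that are not an `o`-bad corner pair
at the corner site. [folklore] -/
def goodSet (o : Orders d n) (γ : Fin n → Fin d × Bool) (w : Site d) : Finset ℕ :=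
  (range ((incTimes γ w).card - 1)).filter fun k =>
    incAt γ w (k + 1) = incAt γ w k + 2 ∧ ¬ (cornerSite γ (incAt γ w k) = w ∧ IsBad o γ (incAt γ w k))

/-- The cylinder "exactly the edges of `A` among the incidence edges are open". [folklore] -/
def cyl (γ : Fin n → Fin d × Bool) (w : Site d) (A : Finset (Sym2 (Site d))) : Set (BondConfig (Site d)) :=
  {ω | (↑A : Set (Sym2 (Site d))) ⊆ ω ∧ Disjoint (↑(incEdges γ w \ A) : Set (Sym2 (Site d))) ω}

/-- Probability of a cylinder at a site: `p^{|A|} (1-p)^{r - |A|}` for `A ⊆ incEdges`. [folklore] -/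
theorem real_cyl (p : unitInterval) (γ : Fin n → Fin d × Bool) (w : Site d) {A : Finset (Sym2 (Site d))}
    (hA : A ⊆ incEdges γ w) :
    (bondPercolation (zdGraph d) p).real (cyl γ w A) = (p : ℝ) ^ A.card * (1 - p : ℝ) ^ ((incEdges γ w).card - A.card) := by
  rw [cyl, bondPercolation_real_open_closed (zdGraph d) p ((coe_subset.2 hA).trans (incEdges_subset_edgeSet γ w))
    ((coe_subset.2 sdiff_subset).trans (incEdges_subset_edgeSet γ w)) disjoint_sdiff, card_sdiff_of_subset hA]

/-- **The open incidence edges form the empty set, a singleton, or a good corner pair.** [folklore] -/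
theorem siteEvt_subset (o : Orders d n) (γ : Fin n → Fin d × Bool) (w : Site d) :
    siteEvt o γ w ⊆ cyl γ w ∅ ∪ (⋃ t ∈ incTimes γ w, cyl γ w {s(wordPos γ t, w)}) ∪
      ⋃ k ∈ goodSet o γ w, cyl γ w {s(wordPos γ (incAt γ w k), w), s(wordPos γ (incAt γ w (k + 1)), w)} := by
  classical
  intro ω hω
  set A := (incTimes γ w).filter fun t => s(wordPos γ t, w) ∈ ω with hA
  -- the closed incidence edges are exactly those with time outside `A`
  have hclosed : ∀ B : Finset (Sym2 (Site d)), (∀ t ∈ A, s(wordPos γ t, w) ∈ B) →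
      Disjoint (↑(incEdges γ w \ B) : Set (Sym2 (Site d))) ω := by
    intro B hB
    rw [Set.disjoint_left]
    intro e he heω
    obtain ⟨he1, he2⟩ := mem_sdiff.1 (mem_coe.1 he)
    obtain ⟨t, ht, rfl⟩ := mem_image.1 he1
    exact he2 (hB t (mem_filter.2 ⟨ht, heω⟩))
  -- any two open incidence times differ by exactly `2`
  have htwo : ∀ a ∈ A, ∀ b ∈ A, a < b → b = a + 2 ∧ ¬ (cornerSite γ a = w ∧ IsBad o γ a) := by
    intro a ha b hb hab
    obtain ⟨ha1, ha2⟩ := mem_filter.1 ha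
    obtain ⟨hb1, hb2⟩ := mem_filter.1 hb
    have hgap := incTimes_gap ha1 hb1 hab
    have hnot : ¬ IsBadPair o γ w a b := fun hbad => hω a ha1 b hb1 hab hbad ⟨ha2, hb2⟩
    simp only [IsBadPair, not_or, not_and] at hnot
    have hb2' : b = a + 2 := by omega
    exact ⟨hb2', fun h => hnot.2 hb2' h.1 h.2⟩
  by_cases hA0 : A = ∅
  · left; left
    refine ⟨by simp, hclosed ∅ fun t ht => ?_⟩
    rw [hA0] at ht; exact absurd ht (Finset.notMem_empty t)
  obtain ⟨a, haA⟩ := Finset.nonempty_iff_ne_empty.2 hA0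
  -- let `a` be the least open incidence time
  set a₀ := A.min' ⟨a, haA⟩ with ha₀
  have ha₀A : a₀ ∈ A := min'_mem _ _
  have ha₀le : ∀ b ∈ A, a₀ ≤ b := fun b hb => min'_le _ _ hb
  obtain ⟨ha₀1, ha₀2⟩ := mem_filter.1 ha₀A
  by_cases hsing : ∀ b ∈ A, b = a₀
  · left; right
    refine Set.mem_biUnion (mem_coe.2 ha₀1) ⟨by simpa using ha₀2, hclosed _ fun t ht => ?_⟩
    rw [hsing t ht]; exact mem_singleton_self _
  push Not at hsing
  obtain ⟨b, hbA, hbne⟩ := hsing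
  have hab : a₀ < b := lt_of_le_of_ne (ha₀le b hbA) (Ne.symm hbne)
  obtain ⟨hb2, hgood⟩ := htwo a₀ ha₀A b hbA hab
  obtain ⟨hb1, hbω⟩ := mem_filter.1 hbA
  -- `A = {a₀, a₀ + 2}`
  have hAeq : ∀ t ∈ A, t = a₀ ∨ t = a₀ + 2 := by
    intro t ht
    by_cases hta : t = a₀
    · exact Or.inl hta
    · exact Or.inr (htwo a₀ ha₀A t ht (lt_of_le_of_ne (ha₀le t ht) (Ne.symm hta))).1
  -- `a₀ = incAt k`, `a₀ + 2 = incAt (k+1)`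
  obtain ⟨k, hk, hka⟩ := exists_incAt_eq ha₀1
  rw [hb2] at hb1 hbω
  obtain ⟨l, hl, hlb⟩ := exists_incAt_eq hb1
  have hkl : k < l := by
    by_contra hle
    have : incAt γ w l ≤ incAt γ w k := by
      rcases Nat.lt_or_ge l k with h | h
      · exact (incAt_strictMono h hk).le
      · have : l = k := by omega
        rw [this]
    omega
  have hl1 : l = k + 1 := by
    by_contra hne
    have hlt : k + 1 < l := by omega
    have h1 := incAt_strictMono (by omega : k < k + 1) (by omega : k + 1 < (incTimes γ w).card)
    have h2 := incAt_strictMono hlt hl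
    have h3 := incTimes_gap (incAt_mem (by omega : k < _)) (incAt_mem (by omega : k + 1 < _)) h1
    have h4 := incTimes_gap (incAt_mem (by omega : k + 1 < _)) (incAt_mem hl) h2
    omega
  subst hl1
  right
  have hkg : k ∈ goodSet o γ w := by
    rw [goodSet, mem_filter, mem_range]
    exact ⟨by omega, by rw [hlb, hka], by rw [hka]; exact hgood⟩
  refine Set.mem_biUnion (mem_coe.2 hkg) ⟨?_, hclosed _ fun t ht => ?_⟩
  · rw [hka, hlb, coe_insert, coe_singleton, Set.insert_subset_iff, Set.singleton_subset_iff]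
    exact ⟨ha₀2, hbω⟩
  · rw [hka, hlb]
    rcases hAeq t ht with rfl | rfl
    · exact mem_insert_self _ _
    · exact mem_insert_of_mem (mem_singleton_self _)

/-- **Per-site probability bound**: `P(siteEvt) ≤ siteProb r g p` with `r = #incTimes`, `g = #goodSet`. [folklore] -/
theorem real_siteEvt_le_siteProb (p : unitInterval) {o : Orders d n} {γ : Fin n → Fin d × Bool} (hs : IsSAW γ)
    {w : Site d} (hw : w ∉ pathSites γ) :
    (bondPercolation (zdGraph d) p).real (siteEvt o γ w) ≤
      siteProb (incTimes γ w).card (goodSet o γ w).card p := by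
  classical
  set μ := bondPercolation (zdGraph d) p with hμ
  set r := (incTimes γ w).card with hr
  have hcardK : (incEdges γ w).card = r := card_incEdges hs hw
  have hp0 : (0 : ℝ) ≤ p := p.2.1
  have hq0 : (0 : ℝ) ≤ 1 - p := sub_nonneg.2 p.2.2
  -- the three families of cylinders
  have h0 : μ.real (cyl γ w ∅) = (1 - p : ℝ) ^ r := by
    rw [hμ, real_cyl p γ w (empty_subset _), card_empty, pow_zero, one_mul, hcardK, Nat.sub_zero]
  have h1 : ∀ t ∈ incTimes γ w, μ.real (cyl γ w {s(wordPos γ t, w)}) = (p : ℝ) * (1 - p : ℝ) ^ (r - 1) := by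
    intro t ht
    rw [hμ, real_cyl p γ w (singleton_subset_iff.2 (mem_image.2 ⟨t, ht, rfl⟩)), card_singleton, pow_one, hcardK]
  have h2 : ∀ k ∈ goodSet o γ w, μ.real (cyl γ w {s(wordPos γ (incAt γ w k), w), s(wordPos γ (incAt γ w (k + 1)), w)})
      = (p : ℝ) ^ 2 * (1 - p : ℝ) ^ (r - 2) := by
    intro k hk
    have hk1 : k + 1 < r := by have := mem_range.1 (mem_filter.1 hk).1; omega
    have hne : s(wordPos γ (incAt γ w k), w) ≠ s(wordPos γ (incAt γ w (k + 1)), w) := by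
      intro h
      have := (eq_of_siteEdge_eq hs hw (mem_incTimes.1 (incAt_mem (by omega : k < r))).1
        (mem_incTimes.1 (incAt_mem hk1)).1 h).2
      have h' := incAt_strictMono (by omega : k < k + 1) hk1
      omega
    rw [hμ, real_cyl p γ w, card_pair hne, hcardK]
    intro e he
    rcases mem_insert.1 he with rfl | he
    · exact mem_image.2 ⟨_, incAt_mem (by omega : k < r), rfl⟩
    · rw [mem_singleton.1 he]; exact mem_image.2 ⟨_, incAt_mem hk1, rfl⟩
  calc μ.real (siteEvt o γ w)
      ≤ μ.real (cyl γ w ∅ ∪ (⋃ t ∈ incTimes γ w, cyl γ w {s(wordPos γ t, w)}) ∪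
          ⋃ k ∈ goodSet o γ w, cyl γ w {s(wordPos γ (incAt γ w k), w), s(wordPos γ (incAt γ w (k + 1)), w)}) :=
        measureReal_mono (siteEvt_subset o γ w)
    _ ≤ μ.real (cyl γ w ∅ ∪ ⋃ t ∈ incTimes γ w, cyl γ w {s(wordPos γ t, w)}) +
          μ.real (⋃ k ∈ goodSet o γ w, cyl γ w {s(wordPos γ (incAt γ w k), w), s(wordPos γ (incAt γ w (k + 1)), w)}) :=
        measureReal_union_le _ _
    _ ≤ (μ.real (cyl γ w ∅) + μ.real (⋃ t ∈ incTimes γ w, cyl γ w {s(wordPos γ t, w)})) +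
          ∑ k ∈ goodSet o γ w, μ.real (cyl γ w {s(wordPos γ (incAt γ w k), w), s(wordPos γ (incAt γ w (k + 1)), w)}) :=
        add_le_add (measureReal_union_le _ _) (measureReal_biUnion_finset_le _ _)
    _ ≤ ((1 - p : ℝ) ^ r + ∑ t ∈ incTimes γ w, μ.real (cyl γ w {s(wordPos γ t, w)})) +
          ∑ k ∈ goodSet o γ w, μ.real (cyl γ w {s(wordPos γ (incAt γ w k), w), s(wordPos γ (incAt γ w (k + 1)), w)}) := by
        rw [h0]; gcongr; exact measureReal_biUnion_finset_le _ _
    _ = (1 - p : ℝ) ^ r + r * ((p : ℝ) * (1 - p : ℝ) ^ (r - 1)) + (goodSet o γ w).card * ((p : ℝ) ^ 2 * (1 - p : ℝ) ^ (r - 2)) := by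
        rw [sum_congr rfl h1, sum_congr rfl h2, sum_const, sum_const, nsmul_eq_mul, nsmul_eq_mul]
    _ = siteProb r (goodSet o γ w).card p := by unfold siteProb; ring

/-- The good pairs are among the `r - 1` consecutive pairs. [folklore] -/
theorem card_goodSet_le (o : Orders d n) (γ : Fin n → Fin d × Bool) (w : Site d) :
    (goodSet o γ w).card + 1 ≤ (incTimes γ w).card ∨ (incTimes γ w).card = 0 := by
  classical
  have := card_filter_le (range ((incTimes γ w).card - 1))
    (fun k => incAt γ w (k + 1) = incAt γ w k + 2 ∧ ¬ (cornerSite γ (incAt γ w k) = w ∧ IsBad o γ (incAt γ w k)))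
  rw [card_range] at this
  unfold goodSet
  omega

/-- If the first pair is not a good corner pair, the good pairs are among the other `r - 2` consecutive pairs. [folklore] -/
theorem card_goodSet_le_of_first {o : Orders d n} {γ : Fin n → Fin d × Bool} {w : Site d} (hr : 2 ≤ (incTimes γ w).card)
    (h0 : ¬ (incAt γ w 1 = incAt γ w 0 + 2 ∧ ¬ (cornerSite γ (incAt γ w 0) = w ∧ IsBad o γ (incAt γ w 0)))) :
    (goodSet o γ w).card + 2 ≤ (incTimes γ w).card := by
  classical
  have hsub : goodSet o γ w ⊆ (range ((incTimes γ w).card - 1)).erase 0 := by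
    intro k hk
    obtain ⟨hk1, hk2⟩ := mem_filter.1 hk
    refine mem_erase.2 ⟨fun hk0 => ?_, hk1⟩
    subst hk0
    exact h0 hk2
  have := card_le_card hsub
  rw [card_erase_of_mem (mem_range.2 (by omega)), card_range] at this
  omega

/-- **Per-site bound in units**: `P(siteEvt o γ w) ≤ s^{detUnits + 2·#badFiber}` for `0 ≤ p ≤ 1/2`, `0 ≤ s ≤ 1`,
`s² ≥ 1 - p²`, `kc ≥ 2`. [folklore] -/
theorem real_siteEvt_le_pow (p : unitInterval) {s : ℝ} (hp : (p : ℝ) ≤ 1 / 2) (hs0 : 0 ≤ s) (hs1 : s ≤ 1)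
    (hps : 1 - (p : ℝ) ^ 2 ≤ s ^ 2) {kc : ℕ} (hkc : 2 ≤ kc) {o : Orders d n} {γ : Fin n → Fin d × Bool} (hsaw : IsSAW γ)
    {w : Site d} (hw : w ∉ pathSites γ) :
    (bondPercolation (zdGraph d) p).real (siteEvt o γ w) ≤ s ^ (detUnits kc γ w + 2 * (badFiber o γ w).card) := by
  classical
  have hp0 : (0 : ℝ) ≤ p := p.2.1
  set r := (incTimes γ w).card with hr
  have hunits := detUnits_add_le hkc γ w
  have hfib := card_badFiber_le_one o γ w
  have hP := real_siteEvt_le_siteProb p (o := o) hsaw hw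
  rw [← hr] at hP hunits
  by_cases hr1 : r ≤ 1
  · -- at most one incidence: no unit, probability ≤ 1
    have hdu : detUnits kc γ w = 0 := detUnits_eq_zero_of_card_le_one (by rw [← hr]; exact hr1)
    have hbf : badFiber o γ w = ∅ := by
      rw [Finset.eq_empty_iff_forall_notMem]
      intro x hx
      have := (eq_incAt_zero_of_mem_badFiber hx).2.1.1
      omega
    rw [hdu, hbf, card_empty, mul_zero, add_zero, pow_zero]
    exact measureReal_le_one
  have hr2 : 2 ≤ r := by omega
  by_cases hne : (badFiber o γ w).Nonempty
  · -- a bad corner first pair: `U = detUnits + 2 ≤ r`, `g ≤ r - 2`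
    obtain ⟨x, hx⟩ := hne
    obtain ⟨hx0, hfc, hbad⟩ := eq_incAt_zero_of_mem_badFiber hx
    have hcard1 : (badFiber o γ w).card = 1 := le_antisymm hfib (card_pos.2 ⟨x, hx⟩)
    have hcw : cornerSite γ (incAt γ w 0) = w := by rw [← hx0]; exact (mem_filter.1 hx).2
    have hg := card_goodSet_le_of_first (o := o) (by rw [← hr]; exact hr2)
      (fun h => h.2 ⟨hcw, by rw [← hx0]; exact hbad⟩)
    rw [← hr] at hg
    rw [if_pos hfc] at hunits
    rw [hcard1, mul_one]
    exact hP.trans (siteProb_le_pow_of_first_bad hp0 hp hs0 hs1 hps hg hunits)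
  · rw [Finset.not_nonempty_iff_eq_empty] at hne
    rw [hne, card_empty, mul_zero, add_zero]
    by_cases hfc : firstCorner γ w
    · -- a good corner first pair: `U = detUnits ≤ r - 2`, `g ≤ r - 1`
      rw [if_pos hfc] at hunits
      have hg : (goodSet o γ w).card + 1 ≤ r := by
        rcases card_goodSet_le o γ w with h | h
        · rw [← hr] at h; exact h
        · rw [← hr] at h; omega
      exact hP.trans (siteProb_le_pow_of_first_good hp0 hp hs0 hs1 hps hg hunits)
    · -- first pair not a corner pair: `U = detUnits ≤ r`, `g ≤ r - 2`
      rw [if_neg hfc, add_zero] at hunits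
      have hg := card_goodSet_le_of_first (o := o) (by rw [← hr]; exact hr2)
        (fun h => hfc ⟨by rw [← hr]; exact hr2, h.1⟩)
      rw [← hr] at hg
      exact hP.trans (siteProb_le_pow_of_first_bad hp0 hp hs0 hs1 hps hg hunits)

end ChainBond

end Summit.CriticalPhenomena.PercolationContinuityZ3.Theorems.Pcint
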